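import Mathlib
import HarnessLib
import Summits.HubbardSuperconductivity.HubbardSuperconductivity.Theorems.KLProgrammeKLRegimeTorusL1MixedDifferencesMoment
import Summits.HubbardSuperconductivity.HubbardSuperconductivity.Theorems.KLProgrammeKLRegimeSectorSliceIncrScaleForm

/-!
# K3 VL child `KLRegimeVolumeLimitV17F2` (stmt-HubbardSuperconductivity-20440), located item #23 «W2-HALF-VL», brick «W2H-OVL» part 8 (RATES, generic):
# the weighted `ℓ¹` bound of a space-time character sum for a symbol with difference data in RELATIVE SCALE FORM, at the two-scale rates
# `s₁ = ρ/x`, `s₂ = s₃′ = ρ/(x|v|)`, `s₃ = ρ₃/(x|v|)` — the thresholds of the mixed master lemma SOLVED by monomial depth conditions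

Cell `gate-hubbard-kl`, seat p3 (g14), lead of #23.  The multiplier-free twin of k3c3-p2's `slicePairWt_charSum_l1_le_famIncrScale` (`…SectorSlicePairFamIncrScale`,
which carries the slice symbol `Ψ̂`): for a symbol `G` on `(ℤ/2M) × (ℤ/L)²` with `‖G‖ ≤ A`, `#{G ≠ 0} ≤ N_s`, third time differences `≤ A·θ₃`, and SPACE
differences in relative scale form — third along the axes and the normal `v⊥` `≤ A·η³(r₃₀ + r₃₁x + r₃₂x² + r₃₃x³)`, third along the tangent `v`
`≤ A·η_v³(rv₃₀ + … + rv₃₃x³)`, second along `v` `≤ A·η_v²(w₀ + w₁x + w₂x²)` (`η = 2π/L`, `η_v = (2π/L)|v|`, depth `x ≥ 1`) — the master lemma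
`sum_wt_norm_charSum_le_of_mixed_differences` (p3 g10) at the rates `s₁ = ρ/x`, `s₂ = s₃′ = ρ/(x|v|)`, `s₃ = ρ₃/(x|v|)` (no finite-volume cut, `R₀ = 0`) gives

* **`charSumWt_le_incrScale`** — `Σ_z (1 + s₀|z̃₁| + (ρ/x)(|z̃₂⁰| + |z̃₂¹|))·‖Σ_q χχ • G(q)‖
  ≤ x·√(524288(1/s₀+1)[(1+4√2)²(2√2/ρ+2)(2√2/ρ₃+2) + (1/ρ+1)²])·√(24·2M·L²·N_s)·A`
  under the time condition `θ₃ ≤ (4/(s₀·2M))³` and the ELEVEN monomial conditions `π³ρ³r₃ᵢ ≤ 2x^{3−i}`, `π³ρ³rv₃ᵢ ≤ 2x^{3−i}` (`i ≤ 3`),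
  `3π²ρ₃²wᵢ ≤ 4x^{2−i}` (`i ≤ 2`) — monotone in `x`, so ONE depth condition at the base of a chain serves all its pieces.

Also the two rate lemmas `incrScale_rate_three_le`, `incrScale_rate_two_le`.  Pure bookkeeping over the master lemma; no definitions, no sorry.  Nothing asserts any
stub, K3, VL or superconductivity. [cite: BenfattoGiulianiMastropietro2006, Lemma 2.2 (2.52)–(2.55), §2.6 (2.81) footnote 1, §3 (3.3)–(3.8)]
-/

noncomputable section

namespace Summit.HubbardSuperconductivity.HubbardSuperconductivity.Theorems.TorusFourierL2

set_option linter.dupNamespace false -- summit = problem name (single-conjunct summit), D-0017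

open Finset Literature.Probability.LatticeModels
open scoped Real

/-! ### §1 The rate arithmetic -/

/-- **Third-order rate**: if `π³ρ³r₃ᵢ ≤ 2x^{3−i}` for `i = 0,…,3` then `(ηV)³(r₃₀ + r₃₁x + r₃₂x² + r₃₃x³) ≤ (4/(s·L))³` for `η = 2π/L`, `s = ρ/(xV)`, any `V > 0`.
[cite: BenfattoGiulianiMastropietro2006, §3 (3.8)] -/
theorem incrScale_rate_three_le {L ρ x V r₀ r₁ r₂ r₃ : ℝ} (hL : 0 < L) (hρ : 0 < ρ) (hx : 1 ≤ x) (hV : 0 < V)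
    (t₀ : π ^ 3 * ρ ^ 3 * r₀ ≤ 2 * x ^ 3) (t₁ : π ^ 3 * ρ ^ 3 * r₁ ≤ 2 * x ^ 2) (t₂ : π ^ 3 * ρ ^ 3 * r₂ ≤ 2 * x) (t₃ : π ^ 3 * ρ ^ 3 * r₃ ≤ 2) :
    (2 * π / L * V) ^ 3 * (r₀ + r₁ * x + r₂ * x ^ 2 + r₃ * x ^ 3) ≤ (4 / (ρ / (x * V) * L)) ^ 3 := by
  have hx0 : 0 < x := lt_of_lt_of_le one_pos hx
  have hπ := Real.pi_pos
  have e : (4 / (ρ / (x * V) * L)) ^ 3 = (2 * π / L * V) ^ 3 * (8 * x ^ 3 / (π ^ 3 * ρ ^ 3)) := by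
    field_simp
    ring
  rw [e]
  refine mul_le_mul_of_nonneg_left ?_ (by positivity)
  rw [le_div_iff₀ (by positivity)]
  have h1 : π ^ 3 * ρ ^ 3 * (r₁ * x) ≤ 2 * x ^ 3 := by
    have := mul_le_mul_of_nonneg_right t₁ hx0.le; nlinarith [this]
  have h2 : π ^ 3 * ρ ^ 3 * (r₂ * x ^ 2) ≤ 2 * x ^ 3 := by
    have := mul_le_mul_of_nonneg_right t₂ (sq_nonneg x); nlinarith [this]
  have h3 : π ^ 3 * ρ ^ 3 * (r₃ * x ^ 3) ≤ 2 * x ^ 3 := by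
    have := mul_le_mul_of_nonneg_right t₃ (pow_nonneg hx0.le 3); nlinarith [this]
  nlinarith [t₀, h1, h2, h3]

/-- **Second-order rate**: if `3π²ρ₃²wᵢ ≤ 4x^{2−i}` for `i = 0, 1, 2` then `(ηV)²(w₀ + w₁x + w₂x²) ≤ (4/(s₃·L))²` for `η = 2π/L`, `s₃ = ρ₃/(xV)`.
[cite: BenfattoGiulianiMastropietro2006, §3 (3.8)] -/
theorem incrScale_rate_two_le {L ρ₃ x V w₀ w₁ w₂ : ℝ} (hL : 0 < L) (hρ : 0 < ρ₃) (hx : 1 ≤ x) (hV : 0 < V)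
    (t₀ : 3 * π ^ 2 * ρ₃ ^ 2 * w₀ ≤ 4 * x ^ 2) (t₁ : 3 * π ^ 2 * ρ₃ ^ 2 * w₁ ≤ 4 * x) (t₂ : 3 * π ^ 2 * ρ₃ ^ 2 * w₂ ≤ 4) :
    (2 * π / L * V) ^ 2 * (w₀ + w₁ * x + w₂ * x ^ 2) ≤ (4 / (ρ₃ / (x * V) * L)) ^ 2 := by
  have hx0 : 0 < x := lt_of_lt_of_le one_pos hx
  have hπ := Real.pi_pos
  have e : (4 / (ρ₃ / (x * V) * L)) ^ 2 = (2 * π / L * V) ^ 2 * (4 * x ^ 2 / (π ^ 2 * ρ₃ ^ 2)) := by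
    field_simp
    ring
  rw [e]
  refine mul_le_mul_of_nonneg_left ?_ (by positivity)
  rw [le_div_iff₀ (by positivity)]
  have h1 : 3 * π ^ 2 * ρ₃ ^ 2 * (w₁ * x) ≤ 4 * x ^ 2 := by
    have := mul_le_mul_of_nonneg_right t₁ hx0.le; nlinarith [this]
  have h2 : 3 * π ^ 2 * ρ₃ ^ 2 * (w₂ * x ^ 2) ≤ 4 * x ^ 2 := by
    have := mul_le_mul_of_nonneg_right t₂ (sq_nonneg x); nlinarith [this]
  nlinarith [t₀, h1, h2]

/-! ### §2 The weighted bound at the two-scale rates -/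

set_option maxHeartbeats 1600000 in
/-- **Weighted `ℓ¹` of a character sum whose symbol has difference data in relative scale form, rates solved** (see the module docstring).
[cite: BenfattoGiulianiMastropietro2006, Lemma 2.2 (2.52)–(2.55), §2.6 (2.81), §3 (3.3)–(3.8)] -/
theorem charSumWt_le_incrScale {L M : ℕ} [NeZero L] [NeZero M] (G : TorusSite 1 (2 * M) × TorusSite 2 L → ℂ)
    (v : Fin 2 → ℤ) (hv : v ≠ 0) {s₀ ρ ρ₃ x A : ℝ} (hs₀ : 0 < s₀) (hρ : 0 < ρ) (hρ₃ : 0 < ρ₃) (hx : 1 ≤ x) (hA : 0 ≤ A)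
    {Ns : ℕ} (hsupp : (univ.filter fun q => G q ≠ 0).card ≤ Ns) (hsup : ∀ q, ‖G q‖ ≤ A)
    -- time, order three, relative
    {θ₃ : ℝ} (h₀ : ∀ q, ‖((fwdDiff ((fun _ : Fin 1 => (1 : ZMod (2 * M))), (0 : TorusSite 2 L)))^[3] G) q‖ ≤ A * θ₃)
    (hθ : θ₃ ≤ (4 / (s₀ * (2 * M : ℕ))) ^ 3)
    -- space, relative scale form: iso family `r` (axes and normal), tangent families `rv` (order three) and `w` (order two)
    {r₃₀ r₃₁ r₃₂ r₃₃ rv₃₀ rv₃₁ rv₃₂ rv₃₃ w₀ w₁ w₂ : ℝ}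
    (h₁ : ∀ q (i : Fin 2), ‖((fwdDiff ((0 : TorusSite 1 (2 * M)), (Pi.single i (1 : ZMod L) : TorusSite 2 L)))^[3] G) q‖ ≤
      A * ((2 * π / L * 1) ^ 3 * (r₃₀ + r₃₁ * x + r₃₂ * x ^ 2 + r₃₃ * x ^ 3)))
    (h₂ : ∀ q, ‖((fwdDiff ((0 : TorusSite 1 (2 * M)), (fun j => ((![-v 1, v 0] j : ℤ) : ZMod L))))^[3] G) q‖ ≤
      A * ((2 * π / L * Real.sqrt ((v 0 : ℝ) ^ 2 + (v 1 : ℝ) ^ 2)) ^ 3 * (r₃₀ + r₃₁ * x + r₃₂ * x ^ 2 + r₃₃ * x ^ 3)))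
    (h₃' : ∀ q, ‖((fwdDiff ((0 : TorusSite 1 (2 * M)), (fun j => ((v j : ℤ) : ZMod L))))^[3] G) q‖ ≤
      A * ((2 * π / L * Real.sqrt ((v 0 : ℝ) ^ 2 + (v 1 : ℝ) ^ 2)) ^ 3 * (rv₃₀ + rv₃₁ * x + rv₃₂ * x ^ 2 + rv₃₃ * x ^ 3)))
    (h₃ : ∀ q, ‖((fwdDiff ((0 : TorusSite 1 (2 * M)), (fun j => ((v j : ℤ) : ZMod L))))^[2] G) q‖ ≤
      A * ((2 * π / L * Real.sqrt ((v 0 : ℝ) ^ 2 + (v 1 : ℝ) ^ 2)) ^ 2 * (w₀ + w₁ * x + w₂ * x ^ 2)))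
    -- the eleven monomial depth conditions
    (t₀ : π ^ 3 * ρ ^ 3 * r₃₀ ≤ 2 * x ^ 3) (t₁ : π ^ 3 * ρ ^ 3 * r₃₁ ≤ 2 * x ^ 2) (t₂ : π ^ 3 * ρ ^ 3 * r₃₂ ≤ 2 * x) (t₃ : π ^ 3 * ρ ^ 3 * r₃₃ ≤ 2)
    (tv₀ : π ^ 3 * ρ ^ 3 * rv₃₀ ≤ 2 * x ^ 3) (tv₁ : π ^ 3 * ρ ^ 3 * rv₃₁ ≤ 2 * x ^ 2) (tv₂ : π ^ 3 * ρ ^ 3 * rv₃₂ ≤ 2 * x) (tv₃ : π ^ 3 * ρ ^ 3 * rv₃₃ ≤ 2)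
    (tw₀ : 3 * π ^ 2 * ρ₃ ^ 2 * w₀ ≤ 4 * x ^ 2) (tw₁ : 3 * π ^ 2 * ρ₃ ^ 2 * w₁ ≤ 4 * x) (tw₂ : 3 * π ^ 2 * ρ₃ ^ 2 * w₂ ≤ 4) :
    ∑ z : TorusSite 1 (2 * M) × TorusSite 2 L,
        (1 + s₀ * |(((z.1 0).valMinAbs : ℤ) : ℝ)| + ρ / x * |(((z.2 0).valMinAbs : ℤ) : ℝ)| + ρ / x * |(((z.2 1).valMinAbs : ℤ) : ℝ)|) *
          ‖∑ q : TorusSite 1 (2 * M) × TorusSite 2 L, (torusChar q.1 z.1 * torusChar q.2 z.2) • G q‖ ≤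
      x * Real.sqrt (524288 * (1 / s₀ + 1) * ((1 + 4 * Real.sqrt 2) ^ 2 * ((2 * Real.sqrt 2 / ρ + 2) * (2 * Real.sqrt 2 / ρ₃ + 2)) + (1 / ρ + 1) ^ 2)) *
        Real.sqrt (24 * (2 * M : ℕ) * (L : ℝ) ^ 2 * Ns) * A := by
  classical
  have hL : (0 : ℝ) < L := Nat.cast_pos.2 (Nat.pos_of_ne_zero (NeZero.ne L))
  have hx0 : 0 < x := lt_of_lt_of_le one_pos hx
  have hπ := Real.pi_pos
  set V : ℝ := Real.sqrt ((v 0 : ℝ) ^ 2 + (v 1 : ℝ) ^ 2) with hVdef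
  have hV : 0 < V := sqrt_sq_add_sq_pos_of_ne_zero v hv
  -- the rates
  have hs₁ : 0 < ρ / x := by positivity
  have hs₂ : 0 < ρ / (x * V) := by positivity
  have hs₃ : 0 < ρ₃ / (x * V) := by positivity
  have hR₀ : 2 * (|v 0| + |v 1|) * ((0 : ℕ) : ℤ) < L := by
    simp only [Nat.cast_zero, mul_zero]; exact_mod_cast Nat.pos_of_ne_zero (NeZero.ne L)
  -- the master hypotheses
  have m0 : ∀ q, ‖((fwdDiff ((fun _ : Fin 1 => (1 : ZMod (2 * M))), (0 : TorusSite 2 L)))^[3] G) q‖ ≤ A * (4 / (s₀ * (2 * M : ℕ))) ^ 3 :=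
    fun q => (h₀ q).trans (mul_le_mul_of_nonneg_left hθ hA)
  have m1 : ∀ q (i : Fin 2), ‖((fwdDiff ((0 : TorusSite 1 (2 * M)), (Pi.single i (1 : ZMod L) : TorusSite 2 L)))^[3] G) q‖ ≤
      A * (4 / (ρ / x * L)) ^ 3 := by
    intro q i
    refine (h₁ q i).trans (mul_le_mul_of_nonneg_left ?_ hA)
    have h := incrScale_rate_three_le hL hρ hx one_pos t₀ t₁ t₂ t₃
    rwa [mul_one (x)] at h
  have m2 : ∀ q, ‖((fwdDiff ((0 : TorusSite 1 (2 * M)), (fun j => ((![-v 1, v 0] j : ℤ) : ZMod L))))^[3] G) q‖ ≤ A * (4 / (ρ / (x * V) * L)) ^ 3 :=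
    fun q => (h₂ q).trans (mul_le_mul_of_nonneg_left (incrScale_rate_three_le hL hρ hx hV t₀ t₁ t₂ t₃) hA)
  have m3' : ∀ q, ‖((fwdDiff ((0 : TorusSite 1 (2 * M)), (fun j => ((v j : ℤ) : ZMod L))))^[3] G) q‖ ≤ A * (4 / (ρ / (x * V) * L)) ^ 3 :=
    fun q => (h₃' q).trans (mul_le_mul_of_nonneg_left (incrScale_rate_three_le hL hρ hx hV tv₀ tv₁ tv₂ tv₃) hA)
  have m3 : ∀ q, ‖((fwdDiff ((0 : TorusSite 1 (2 * M)), (fun j => ((v j : ℤ) : ZMod L))))^[2] G) q‖ ≤ A * (4 / (ρ₃ / (x * V) * L)) ^ 2 :=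
    fun q => (h₃ q).trans (mul_le_mul_of_nonneg_left (incrScale_rate_two_le hL hρ₃ hx hV tw₀ tw₁ tw₂) hA)
  have main := sum_wt_norm_charSum_le_of_mixed_differences G v hv hs₀ hs₁ hs₂ hs₃ hs₂ hR₀ hA hsupp hsup m0 m1 m2 m3 m3'
  refine main.trans ?_
  rw [← hVdef]
  -- the bracket at the two-scale rates is `≤ x²·[…]`
  have hCw : 1 + 2 * Real.sqrt 2 * (ρ / x) / (ρ / (x * V) * V) + 2 * Real.sqrt 2 * (ρ / x) / (ρ / (x * V) * V) = 1 + 4 * Real.sqrt 2 := by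
    field_simp; ring
  have hn2 : 2 * Real.sqrt 2 / (ρ / (x * V) * V) + 2 = 2 * Real.sqrt 2 * x / ρ + 2 := by field_simp
  have hn3 : 2 * Real.sqrt 2 / (ρ₃ / (x * V) * V) + 2 = 2 * Real.sqrt 2 * x / ρ₃ + 2 := by field_simp
  have hfar : (1 / (ρ / x) + 1) ^ 2 / (1 + ρ / x * ((0 : ℕ) : ℝ)) = (x / ρ + 1) ^ 2 := by
    rw [Nat.cast_zero, mul_zero, add_zero, div_one, one_div_div]
  rw [hCw, hn2, hn3, hfar]
  have hs2 : 0 ≤ Real.sqrt 2 := Real.sqrt_nonneg _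
  have b1 : 2 * Real.sqrt 2 * x / ρ + 2 ≤ x * (2 * Real.sqrt 2 / ρ + 2) := by
    rw [mul_add, mul_div_assoc', mul_comm x (2 * Real.sqrt 2)]
    nlinarith [hx]
  have b2 : 2 * Real.sqrt 2 * x / ρ₃ + 2 ≤ x * (2 * Real.sqrt 2 / ρ₃ + 2) := by
    rw [mul_add, mul_div_assoc', mul_comm x (2 * Real.sqrt 2)]
    nlinarith [hx]
  have b3 : (x / ρ + 1) ^ 2 ≤ x ^ 2 * (1 / ρ + 1) ^ 2 := by
    rw [← mul_pow]
    refine pow_le_pow_left₀ (by positivity) ?_ 2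
    rw [mul_add, mul_one_div]
    nlinarith [hx]
  have b10 : 0 ≤ 2 * Real.sqrt 2 * x / ρ + 2 := by positivity
  have b20 : 0 ≤ 2 * Real.sqrt 2 * x / ρ₃ + 2 := by positivity
  have hbr : (1 + 4 * Real.sqrt 2) ^ 2 * ((2 * Real.sqrt 2 * x / ρ + 2) * (2 * Real.sqrt 2 * x / ρ₃ + 2)) + (x / ρ + 1) ^ 2 ≤
      x ^ 2 * ((1 + 4 * Real.sqrt 2) ^ 2 * ((2 * Real.sqrt 2 / ρ + 2) * (2 * Real.sqrt 2 / ρ₃ + 2)) + (1 / ρ + 1) ^ 2) := by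
    have p : (2 * Real.sqrt 2 * x / ρ + 2) * (2 * Real.sqrt 2 * x / ρ₃ + 2) ≤ (x * (2 * Real.sqrt 2 / ρ + 2)) * (x * (2 * Real.sqrt 2 / ρ₃ + 2)) :=
      mul_le_mul b1 b2 b20 (by positivity)
    have p' := mul_le_mul_of_nonneg_left p (sq_nonneg (1 + 4 * Real.sqrt 2))
    nlinarith [p', b3]
  have hsq : Real.sqrt (524288 * (1 / s₀ + 1) *
        ((1 + 4 * Real.sqrt 2) ^ 2 * ((2 * Real.sqrt 2 * x / ρ + 2) * (2 * Real.sqrt 2 * x / ρ₃ + 2)) + (x / ρ + 1) ^ 2)) ≤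
      x * Real.sqrt (524288 * (1 / s₀ + 1) * ((1 + 4 * Real.sqrt 2) ^ 2 * ((2 * Real.sqrt 2 / ρ + 2) * (2 * Real.sqrt 2 / ρ₃ + 2)) + (1 / ρ + 1) ^ 2)) := by
    rw [← Real.sqrt_sq hx0.le, ← Real.sqrt_mul (sq_nonneg x), Real.sqrt_sq hx0.le]
    refine Real.sqrt_le_sqrt ?_
    have e : x ^ 2 * (524288 * (1 / s₀ + 1) * ((1 + 4 * Real.sqrt 2) ^ 2 * ((2 * Real.sqrt 2 / ρ + 2) * (2 * Real.sqrt 2 / ρ₃ + 2)) + (1 / ρ + 1) ^ 2)) =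
        524288 * (1 / s₀ + 1) * (x ^ 2 * ((1 + 4 * Real.sqrt 2) ^ 2 * ((2 * Real.sqrt 2 / ρ + 2) * (2 * Real.sqrt 2 / ρ₃ + 2)) + (1 / ρ + 1) ^ 2)) := by
      ring
    rw [e]
    exact mul_le_mul_of_nonneg_left hbr (by positivity)
  have hrest : 0 ≤ Real.sqrt (24 * (2 * M : ℕ) * (L : ℝ) ^ 2 * Ns) * A := by positivity
  calc _ ≤ x * Real.sqrt (524288 * (1 / s₀ + 1) * ((1 + 4 * Real.sqrt 2) ^ 2 * ((2 * Real.sqrt 2 / ρ + 2) * (2 * Real.sqrt 2 / ρ₃ + 2)) + (1 / ρ + 1) ^ 2)) *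
        (Real.sqrt (24 * (2 * M : ℕ) * (L : ℝ) ^ 2 * Ns) * A) := by
          rw [mul_assoc (Real.sqrt _)]
          exact mul_le_mul_of_nonneg_right hsq hrest
    _ = _ := by ring

end Summit.HubbardSuperconductivity.HubbardSuperconductivity.Theorems.TorusFourierL2

end
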